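import Literature.NumberTheory.GaloisRepresentations.EnormousSubgroup
import Literature.NumberTheory.GaloisRepresentations.PadicAlgClFiniteSubextensionDvr
import Literature.NumberTheory.GaloisRepresentations.CalegariEvenFontaineMazurTwo
import Literature.RingTheory.Valuation.AlgClosedResidue
import Mathlib.LinearAlgebra.Matrix.GeneralLinearGroup.Basic
import Mathlib.LinearAlgebra.Matrix.Charpoly.Basic
import Mathlib.FieldTheory.Separable
import Mathlib.FieldTheory.Finite.Basic
import Mathlib.NumberTheory.Padics.RingHoms
import HarnessLib

/-!
# Route `RamifiedCoefficientSeed`, crux `AdjointLiftingGL3` (stmt-Langlands-16779), line `birth`: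
# stub `stub_enormousAd`, part I — preliminaries

Elementary facts feeding the proof that `ρ̄(Γ_{ℚ(ζ_p)})` is enormous (ACC+ Def. 6.2.28, tree
structure `Subgroup.IsEnormous` of
`Literature/NumberTheory/GaloisRepresentations/EnormousSubgroup`):

* regular semisimplicity (`IsRegularSemisimple`: separable characteristic polynomial) is invariant
  under scalars and conjugation (`isRegularSemisimple_scalar_mul_conj`), via
  `c⁻ⁿ · charpoly(c M) = charpoly(M) ∘ (c⁻¹ X)` (`C_mul_charpoly_smul`);
* the adjoint action `(adZero (Fin n) k).toRepresentation` of `GL_n(k)` on `ad⁰` (of which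
  `Subgroup.adZeroRep H` is the restriction): scalars act trivially (`adGL_scalar`), and the
  bookkeeping of "lifts"
  `x = c · g h' g⁻¹` (`exists_scalar_mem_of_eq`, `lift_mul_eq`);
* the residue field `k = ℤ̄_p/𝔪` (`padicAlgClResidueField p`) is an algebraic closure of `𝔽_p`
  (`isAlgClosure_zmod_padicAlgClResidueField`: algebraically closed by the tree's
  `Literature.RingTheory.Valuation.isAlgClosed_residueField`, algebraic because an element of
  `ℤ̄_p` is integral over `ℤ_p` — tree `PadicAlgCl.norm_le_one_iff_isIntegral` — and a monic
  integral equation reduces to one over `𝔽_p`, the reduction `ℤ_p → ℤ̄_p → k` being `ℤ_p → 𝔽_p → k`,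
  `ringHom_padicInt_eq_comp_toZMod`) — this is the "`GL_n(𝔽̄_l)`" of ACC+ §7.1 —, and
  consequently every unit of `k` has finite order prime to `p`
  (`exists_pow_eq_one_of_isAlgebraic`, `exists_pow_eq_one_padicAlgClResidueField`), the input of
  the transfer theorem of part II.

References: [ACCGHLNSTT2023] Def. 6.2.28 (held arXiv:1812.09999 §6.2.9); J.-P. Serre, *Local
Fields*, Ch. II §2 (residue fields); all statements here are folklore.
-/

set_option linter.dupNamespace false

noncomputable section

namespace Summit.Langlands.Langlands.Cruxes.AdjointLiftingGL3.Birth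

open scoped MatrixGroups Polynomial
open Literature.NumberTheory.GaloisRepresentations Matrix Polynomial

variable {k : Type*} [Field k] {n : ℕ}

/-! ## Regular semisimplicity under scalars and conjugation -/

/-- `p ∘ (bX)` is separable when `p` is and `b ≠ 0` (its derivative is `b · p' ∘ (bX)`).
[folklore] -/
theorem separable_comp_C_mul_X {p : k[X]} (hp : p.Separable) {b : k} (hb : b ≠ 0) :
    (p.comp (C b * X)).Separable := by
  have h := IsCoprime.map hp (Polynomial.compRingHom (C b * X))
  rw [Polynomial.coe_compRingHom_apply, Polynomial.coe_compRingHom_apply] at h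
  unfold Polynomial.Separable
  rw [Polynomial.derivative_comp, Polynomial.derivative_C_mul_X]
  exact (isCoprime_mul_unit_left_right (Polynomial.isUnit_C.mpr (IsUnit.mk0 b hb)) _ _).mpr h

/-- **Characteristic polynomial of a scalar multiple**: for a unit `c`,
`c⁻ⁿ · charpoly(c M) = charpoly(M) ∘ (c⁻¹ X)` (apply the substitution `X ↦ c⁻¹ X` to the
characteristic matrix). [folklore] -/
theorem C_mul_charpoly_smul (c : kˣ) (M : Matrix (Fin n) (Fin n) k) :
    C (((c⁻¹ : kˣ) : k) ^ n) * ((c : k) • M).charpoly =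
      M.charpoly.comp (C ((c⁻¹ : kˣ) : k) * X) := by
  set φ : k[X] →+* k[X] := Polynomial.compRingHom (C ((c⁻¹ : kˣ) : k) * X) with hφdef
  have hφ : φ.mapMatrix (charmatrix M) = C ((c⁻¹ : kˣ) : k) • charmatrix ((c : k) • M) := by
    refine Matrix.ext fun i j => ?_
    simp only [RingHom.mapMatrix_apply, Matrix.map_apply, Matrix.smul_apply, charmatrix_apply,
      hφdef, Polynomial.coe_compRingHom_apply, smul_eq_mul, Matrix.diagonal_apply]
    split_ifs with hij
    · rw [Polynomial.sub_comp, Polynomial.X_comp, Polynomial.C_comp, mul_sub, ← C_mul,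
        ← mul_assoc, Units.inv_mul, one_mul]
    · rw [zero_sub, zero_sub, Polynomial.neg_comp, Polynomial.C_comp, mul_neg, ← C_mul,
        ← mul_assoc, Units.inv_mul, one_mul]
  calc C (((c⁻¹ : kˣ) : k) ^ n) * ((c : k) • M).charpoly
      = (C ((c⁻¹ : kˣ) : k) • charmatrix ((c : k) • M)).det := by
        rw [Matrix.det_smul, Fintype.card_fin, Matrix.charpoly, C_pow]
    _ = (φ.mapMatrix (charmatrix M)).det := by rw [hφ]
    _ = φ M.charpoly := by rw [Matrix.charpoly, RingHom.map_det]
    _ = M.charpoly.comp _ := Polynomial.coe_compRingHom_apply _ _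

/-- **Regular semisimplicity is invariant under scalars and conjugation**: if `h` is regular
semisimple then so is `c · g h g⁻¹` (same eigenvalue pattern, scaled by `c`). [folklore] -/
theorem isRegularSemisimple_scalar_mul_conj (c : kˣ) (g : GL (Fin n) k) {h : GL (Fin n) k}
    (hh : IsRegularSemisimple h) :
    IsRegularSemisimple (GeneralLinearGroup.scalar (Fin n) c * g * h * g⁻¹) := by
  rw [isRegularSemisimple_iff] at hh ⊢
  have hconj : ((g * h * g⁻¹ : GL (Fin n) k) : Matrix (Fin n) (Fin n) k).charpoly =
      ((h : GL (Fin n) k) : Matrix (Fin n) (Fin n) k).charpoly := by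
    rw [Units.val_mul, Units.val_mul, Matrix.coe_units_inv, Matrix.charpoly_units_conj]
  have hval : ((GeneralLinearGroup.scalar (Fin n) c * g * h * g⁻¹ : GL (Fin n) k) :
      Matrix (Fin n) (Fin n) k) =
        (c : k) • ((g * h * g⁻¹ : GL (Fin n) k) : Matrix (Fin n) (Fin n) k) := by
    rw [mul_assoc, mul_assoc, Units.val_mul, GeneralLinearGroup.coe_scalar, ← mul_assoc,
      Units.val_mul, Units.val_mul, Matrix.scalar_apply]
    exact (Matrix.smul_eq_diagonal_mul _ _).symm
  rw [hval]
  have h1 : (C (((c⁻¹ : kˣ) : k) ^ n) * ((c : k) •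
      ((g * h * g⁻¹ : GL (Fin n) k) : Matrix (Fin n) (Fin n) k)).charpoly).Separable := by
    rw [C_mul_charpoly_smul, hconj]
    exact separable_comp_C_mul_X hh (Units.ne_zero _)
  exact h1.of_mul_right

/-! ## The adjoint action of `GL_n(k)` on `ad⁰`: scalars act trivially

Below `Ad = (adZero (Fin n) k).toRepresentation` is the representation of `GL_n(k)` on `ad⁰`
(`M ↦ g M g⁻¹` on trace-zero matrices), of which `Subgroup.adZeroRep H` is the restriction; the
lemma names abbreviate it `adGL`. -/

/-- `Subgroup.adZeroRep H x = Ad (x : GL_n(k))` (definitional). [folklore] -/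
theorem adZeroRep_apply (H : Subgroup (GL (Fin n) k)) (x : H) :
    Subgroup.adZeroRep H x = (adZero (Fin n) k).toRepresentation (x : GL (Fin n) k) := rfl

/-- The `ρ` of the bundled `Rep.of (adZeroRep H)` is `Ad` (definitional). [folklore] -/
theorem rep_ρ_apply (H : Subgroup (GL (Fin n) k)) (x : H) (v : (adZero (Fin n) k).toSubmodule) :
    (Rep.of (Subgroup.adZeroRep H)).ρ x v =
      (adZero (Fin n) k).toRepresentation (x : GL (Fin n) k) v := rfl

/-- Underlying matrix of `Ad g M`: `g M g⁻¹`. [folklore] -/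
theorem coe_adGL_apply (g : GL (Fin n) k) (M : (adZero (Fin n) k).toSubmodule) :
    (((adZero (Fin n) k).toRepresentation g M : (adZero (Fin n) k).toSubmodule) :
        Matrix (Fin n) (Fin n) k) =
      ((g : GL (Fin n) k) : Matrix (Fin n) (Fin n) k) * (M : Matrix (Fin n) (Fin n) k) *
        ((g⁻¹ : GL (Fin n) k) : Matrix (Fin n) (Fin n) k) := rfl

/-- `Ad (x y) M = Ad x (Ad y M)`. [folklore] -/
theorem adGL_mul_apply (x y : GL (Fin n) k) (M : (adZero (Fin n) k).toSubmodule) :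
    (adZero (Fin n) k).toRepresentation (x * y) M =
      (adZero (Fin n) k).toRepresentation x ((adZero (Fin n) k).toRepresentation y M) := by
  rw [map_mul, Module.End.mul_apply]

/-- `Ad g⁻¹ (Ad g M) = M`. [folklore] -/
@[simp] theorem adGL_inv_apply_self (g : GL (Fin n) k) (M : (adZero (Fin n) k).toSubmodule) :
    (adZero (Fin n) k).toRepresentation g⁻¹ ((adZero (Fin n) k).toRepresentation g M) = M := by
  rw [← adGL_mul_apply, inv_mul_cancel, map_one, Module.End.one_apply]

/-- `Ad g (Ad g⁻¹ M) = M`. [folklore] -/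
@[simp] theorem adGL_apply_inv_self (g : GL (Fin n) k) (M : (adZero (Fin n) k).toSubmodule) :
    (adZero (Fin n) k).toRepresentation g ((adZero (Fin n) k).toRepresentation g⁻¹ M) = M := by
  rw [← adGL_mul_apply, mul_inv_cancel, map_one, Module.End.one_apply]

/-- **Scalars act trivially on `ad⁰`**: `Ad (c · 1) = 1`. [folklore] -/
theorem adGL_scalar (c : kˣ) :
    (adZero (Fin n) k).toRepresentation (GeneralLinearGroup.scalar (Fin n) c) = 1 := by
  refine LinearMap.ext fun M => Subtype.ext ?_
  rw [coe_adGL_apply, ← map_inv, GeneralLinearGroup.coe_scalar, GeneralLinearGroup.coe_scalar,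
    Module.End.one_apply, Matrix.scalar_apply, Matrix.scalar_apply, ← Matrix.smul_eq_diagonal_mul,
    Matrix.smul_mul, ← Matrix.smul_eq_mul_diagonal, smul_smul, Units.val_inv_eq_inv_val,
    mul_inv_cancel₀ (Units.ne_zero c), one_smul]

/-- If `x = c · g h' g⁻¹` then `Ad(x) = Ad(g) Ad(h') Ad(g)⁻¹` on `ad⁰`. [folklore] -/
theorem adGL_eq_of_eq_scalar_mul_conj {x h' g : GL (Fin n) k} {c : kˣ}
    (hx : x = GeneralLinearGroup.scalar (Fin n) c * g * h' * g⁻¹) :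
    (adZero (Fin n) k).toRepresentation x =
      (adZero (Fin n) k).toRepresentation g * (adZero (Fin n) k).toRepresentation h' *
        (adZero (Fin n) k).toRepresentation g⁻¹ := by
  rw [hx, map_mul, map_mul, map_mul, adGL_scalar, one_mul]

/-! ## Lifts along "same projective image" -/

/-- Two elements of `H` over the same `h'` differ by a scalar lying in `H`. [folklore] -/
theorem exists_scalar_mem_of_eq {H : Subgroup (GL (Fin n) k)} {x y h' g : GL (Fin n) k} {c d : kˣ}
    (hx : x = GeneralLinearGroup.scalar (Fin n) c * g * h' * g⁻¹)
    (hy : y = GeneralLinearGroup.scalar (Fin n) d * g * h' * g⁻¹) (hxH : x ∈ H) (hyH : y ∈ H) :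
    ∃ e : kˣ, GeneralLinearGroup.scalar (Fin n) e ∈ H ∧
      x = GeneralLinearGroup.scalar (Fin n) e * y := by
  refine ⟨c * d⁻¹, ?_, ?_⟩
  · have h1 : GeneralLinearGroup.scalar (Fin n) (c * d⁻¹) = x * y⁻¹ := by
      rw [hx, hy, map_mul, map_inv]; group
    rw [h1]
    exact H.mul_mem hxH (H.inv_mem hyH)
  · rw [hx, hy, map_mul, map_inv]; group

/-- Products of lifts: `(c_a g a g⁻¹)(c_b g b g⁻¹) = c_a c_b · g (ab) g⁻¹` (scalars are central).
[folklore] -/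
theorem lift_mul_eq {a b g La Lb : GL (Fin n) k} {ca cb : kˣ}
    (ha : La = GeneralLinearGroup.scalar (Fin n) ca * g * a * g⁻¹)
    (hb : Lb = GeneralLinearGroup.scalar (Fin n) cb * g * b * g⁻¹) :
    La * Lb = GeneralLinearGroup.scalar (Fin n) (ca * cb) * g * (a * b) * g⁻¹ := by
  have hz : g * a * g⁻¹ * GeneralLinearGroup.scalar (Fin n) cb =
      GeneralLinearGroup.scalar (Fin n) cb * (g * a * g⁻¹) :=
    (GeneralLinearGroup.scalar_commute cb _).symm
  rw [ha, hb, map_mul]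
  calc GeneralLinearGroup.scalar (Fin n) ca * g * a * g⁻¹ *
        (GeneralLinearGroup.scalar (Fin n) cb * g * b * g⁻¹)
      = GeneralLinearGroup.scalar (Fin n) ca *
          (g * a * g⁻¹ * GeneralLinearGroup.scalar (Fin n) cb) * (g * b * g⁻¹) := by group
    _ = GeneralLinearGroup.scalar (Fin n) ca *
          (GeneralLinearGroup.scalar (Fin n) cb * (g * a * g⁻¹)) * (g * b * g⁻¹) := by rw [hz]
    _ = GeneralLinearGroup.scalar (Fin n) ca * GeneralLinearGroup.scalar (Fin n) cb * g * (a * b) *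
          g⁻¹ := by group


/-! ## Units algebraic over `𝔽_p` have finite order prime to `p` -/

/-- **A non-zero element algebraic over `𝔽_p` is a root of unity of order prime to `p`**: it lies
in the finite field `𝔽_p(a)` of order `q = p^d`, so `a^{q-1} = 1` and `p ∤ q - 1`. [folklore] -/
theorem exists_pow_eq_one_of_isAlgebraic {k : Type*} [Field k] {p : ℕ} [Fact p.Prime]
    [Algebra (ZMod p) k] {a : k} (halg : IsAlgebraic (ZMod p) a) (ha : a ≠ 0) :
    ∃ m : ℕ, ¬ p ∣ m ∧ a ^ m = 1 := by
  classical
  have hp : p.Prime := Fact.out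
  set K' := IntermediateField.adjoin (ZMod p) ({a} : Set k) with hK'
  haveI : FiniteDimensional (ZMod p) K' :=
    IntermediateField.adjoin.finiteDimensional halg.isIntegral
  haveI : Finite K' := Module.finite_of_finite (ZMod p)
  letI : Fintype K' := Fintype.ofFinite K'
  haveI : CharP K' p := charP_of_injective_algebraMap (algebraMap (ZMod p) K').injective p
  set a' : K' := ⟨a, IntermediateField.mem_adjoin_simple_self (ZMod p) a⟩ with ha'def
  have ha' : a' ≠ 0 := fun h => ha (by simpa [ha'def] using congrArg Subtype.val h)
  have hpow : a' ^ (Fintype.card K' - 1) = 1 := FiniteField.pow_card_sub_one_eq_one a' ha'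
  obtain ⟨d, -, hcard⟩ := FiniteField.card K' p
  refine ⟨Fintype.card K' - 1, ?_, ?_⟩
  · rw [hcard]
    intro hdvd
    have h1 : p ∣ p ^ (d : ℕ) - (p ^ (d : ℕ) - 1) :=
      Nat.dvd_sub (dvd_pow_self p (PNat.ne_zero d)) hdvd
    rw [Nat.sub_sub_self (Nat.one_le_pow _ _ hp.pos)] at h1
    exact hp.one_lt.ne' (Nat.dvd_one.mp h1)
  · have h := congrArg Subtype.val hpow
    simpa [ha'def] using h

/-! ## `ℤ̄_p/𝔪` is algebraic over `𝔽_p` -/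

/-- **A ring homomorphism `ℤ_p → K` to a ring of characteristic `p` factors through `ℤ_p → 𝔽_p`**:
`z ≡ (z mod p) (mod p ℤ_p)` (Mathlib `PadicInt.toZMod_spec`) and `p = 0` in `K`. [folklore] -/
theorem ringHom_padicInt_eq_comp_toZMod {p : ℕ} [Fact p.Prime] {K : Type*} [CommRing K] [CharP K p]
    (φ : ℤ_[p] →+* K) (ψ : ZMod p →+* K) : φ = ψ.comp PadicInt.toZMod := by
  rw [Subsingleton.elim ψ (ZMod.castHom (dvd_refl p) K)]
  refine RingHom.ext fun z => ?_
  have hz := PadicInt.toZMod_spec z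
  rw [PadicInt.maximalIdeal_eq_span_p, Ideal.mem_span_singleton] at hz
  obtain ⟨w, hw⟩ := hz
  have h1 : φ z - φ ((PadicInt.toZMod z).cast : ℤ_[p]) = 0 := by
    rw [← map_sub, hw, map_mul, map_natCast, CharP.cast_eq_zero, zero_mul]
  rw [sub_eq_zero] at h1
  rw [h1, RingHom.comp_apply, ZMod.castHom_apply, ZMod.cast_eq_val, map_natCast, ZMod.cast_eq_val]

/-- **`ℤ̄_p/𝔪` is algebraic over `𝔽_p`**: `x ∈ ℤ̄_p` is integral over `ℤ_p`
(`PadicAlgCl.norm_le_one_iff_isIntegral`), and a monic equation `f(x) = 0`, `f ∈ ℤ_p[X]`, reduces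
to the monic equation `f̄(x̄) = 0` over `𝔽_p`. [folklore] -/
theorem isAlgebraic_zmod_padicAlgClResidueField (p : ℕ) [Fact p.Prime] :
    letI := charP_padicAlgClResidueField p
    letI := ZMod.algebra (padicAlgClResidueField p) p
    Algebra.IsAlgebraic (ZMod p) (padicAlgClResidueField p) := by
  letI := charP_padicAlgClResidueField p
  letI := ZMod.algebra (padicAlgClResidueField p) p
  -- the structure map `ℤ_p → ℤ̄_p` (`‖z‖ ≤ 1` for `z ∈ ℤ_p`)
  let ι : ℤ_[p] →+* padicAlgClIntegers p :=
    (algebraMap ℤ_[p] (PadicAlgCl p)).codRestrict (padicAlgClIntegers p).toSubring fun z => by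
      change algebraMap ℤ_[p] (PadicAlgCl p) z ∈ padicAlgClIntegers p
      rw [Valuation.mem_valuationSubring_iff, PadicAlgCl.valuation_def,
        IsScalarTower.algebraMap_apply ℤ_[p] ℚ_[p] (PadicAlgCl p), ← NNReal.coe_le_coe, coe_nnnorm]
      change ‖((z : ℚ_[p]) : PadicAlgCl p)‖ ≤ 1
      rw [PadicAlgCl.norm_extends, PadicInt.padic_norm_e_of_padicInt]
      exact z.norm_le_one
  have hι : (padicAlgClIntegers p).toSubring.subtype.comp ι = algebraMap ℤ_[p] (PadicAlgCl p) :=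
    RingHom.ext fun _ => rfl
  refine ⟨fun a => ?_⟩
  obtain ⟨x, rfl⟩ := IsLocalRing.residue_surjective a
  have hint : IsIntegral ℤ_[p] (x : PadicAlgCl p) := by
    rw [← PadicAlgCl.norm_le_one_iff_isIntegral]
    have hx := (Valuation.mem_valuationSubring_iff _ _).mp x.2
    rwa [PadicAlgCl.valuation_def, ← NNReal.coe_le_coe, coe_nnnorm] at hx
  obtain ⟨f, hfmonic, hfx⟩ := hint
  refine ⟨f.map PadicInt.toZMod, (hfmonic.map _).ne_zero, ?_⟩
  rw [Polynomial.aeval_def, Polynomial.eval₂_map,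
    ← ringHom_padicInt_eq_comp_toZMod ((IsLocalRing.residue _).comp ι), ← Polynomial.hom_eval₂]
  have h0 : Polynomial.eval₂ ι x f = 0 := by
    apply Subtype.val_injective
    change (padicAlgClIntegers p).toSubring.subtype (Polynomial.eval₂ ι x f) = 0
    rw [Polynomial.hom_eval₂, hι]
    exact hfx
  rw [h0, map_zero]

/-- **`ℤ̄_p/𝔪` is an algebraic closure of `𝔽_p`** (algebraically closed:
`Literature.RingTheory.Valuation.isAlgClosed_residueField`; algebraic: the previous theorem) — the
"`𝔽̄_l`" of ACC+ §7.1. [folklore] -/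
theorem isAlgClosure_zmod_padicAlgClResidueField (p : ℕ) [Fact p.Prime] :
    letI := charP_padicAlgClResidueField p
    letI := ZMod.algebra (padicAlgClResidueField p) p
    IsAlgClosure (ZMod p) (padicAlgClResidueField p) := by
  letI := charP_padicAlgClResidueField p
  letI := ZMod.algebra (padicAlgClResidueField p) p
  exact ⟨Literature.RingTheory.Valuation.isAlgClosed_residueField (padicAlgClIntegers p),
    isAlgebraic_zmod_padicAlgClResidueField p⟩

/-- **Every unit of `ℤ̄_p/𝔪` has finite order prime to `p`.** [folklore] -/
theorem exists_pow_eq_one_padicAlgClResidueField :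
    ∀ (p : ℕ) [Fact p.Prime] (a : (padicAlgClResidueField p)ˣ), ∃ m : ℕ, ¬ p ∣ m ∧ a ^ m = 1 := by
  intro p _ a
  letI := charP_padicAlgClResidueField p
  letI := ZMod.algebra (padicAlgClResidueField p) p
  haveI := isAlgebraic_zmod_padicAlgClResidueField p
  obtain ⟨m, hpm, ham⟩ := exists_pow_eq_one_of_isAlgebraic
    (Algebra.IsAlgebraic.isAlgebraic (R := ZMod p) (a : padicAlgClResidueField p)) (Units.ne_zero a)
  exact ⟨m, hpm, Units.ext (by rw [Units.val_pow_eq_pow_val, ham, Units.val_one])⟩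

end Summit.Langlands.Langlands.Cruxes.AdjointLiftingGL3.Birth

end
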